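import Literature.AlgebraicGeometry.HodgeTheory.AbsoluteHodgeClassesKunnethComponentsExist
import Literature.AlgebraicGeometry.HodgeTheory.CrossProductTopClass
import Literature.AlgebraicGeometry.HodgeTheory.AlgebraicClassesExteriorProduct
import Literature.AlgebraicGeometry.HodgeTheory.BettiUniverseTracePairing
import Literature.AlgebraicGeometry.HodgeTheory.BettiUniverseKunnethHodgePowersNormalForm
import HarnessLib

/-!
# The middle Künneth component of the diagonal: the Poincaré Casimir of `Hⁿ(X; ℚ)` is algebraic on `X × X`

Family `hodge`, layer `Literature/AlgebraicGeometry/HodgeTheory`; written for the crux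
`PowersHodgeOfSignCommutators` (stmt-HodgeConjecture-19717, K2-B line `kunneth-tensor-fft`, stub A
`stub_matchingClassesAlgebraic`) of the route `HodgeConjecture/SignSymmetricPowers`, and its twin on
`HodgeConjecture/CyclicUnitaryPowers`. Theorems only; no definition, no named fact (D-0026).

For `X` smooth projective of dimension `n` over `ℂ` and a `ℚ`-basis `b` of `Hⁿ(X(ℂ); ℚ)` with Gram matrix
`Q = (tr(bᵢ ∪ bⱼ))` of the light trace form (`BettiUniverseAxioms.tr`, `BettiUniverseTracePairing`), the
**Poincaré Casimir** is `κ = Σᵢⱼ (Q⁻¹)ᵢⱼ · pr₁^* bᵢ ∪ pr₂^* bⱼ ∈ H²ⁿ((X × X)(ℂ); ℚ)`. Classically,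
`±κ` is the Künneth component `πⁿ ∈ Hⁿ(X) ⊗ Hⁿ(X)` of the class of the diagonal
(Milnor–Stasheff Thm. 11.11; Voisin I §11.3.3; Deligne 1982 Ex. 2.1 (b): `cl(Δ) = Σᵢ πⁱ`), and when the
cohomology of `X` off the middle degree is algebraic (odd Betti numbers `0`, even cohomology spanned by
algebraic classes — e.g. smooth hypersurfaces), `πⁿ = cl(Δ) − Σ_{i ≠ n} πⁱ` is ALGEBRAIC. Main theorem:

* `ofRatClass_casimir_mem_algebraicClasses` — under these hypotheses `κ ⊗ 1 ∈ Nⁿ H²ⁿ((X ⊗ X)(ℂ); ℂ)`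
  (`algebraicClasses (X ⊗ X) n`; the cup product on `X ⊗ X` is taken in degree `2p`, `n + n = 2p`).

Proof. `cl(Δ) = diagonalClass hX = Δ_* 1` is algebraic (`diagonalClass_mem_algebraicClasses`) and splits
into Künneth pieces (`exists_sum_kunnethPiece_eq`); the pieces `H^{2n−i} ⊗ Hⁱ`, `i ≠ n`, are algebraic
(`kunnethPiece_le_algebraicClasses_of_ne`: zero for `i` odd, exterior products of algebraic classes for
`i` even, `cupProduct_map_fst_map_snd_mem_algebraicClasses`), so the middle piece `G = πⁿ` is algebraic
(`exists_middle_kunnethComponent_diagonalClass`). The identification `cX · (κ ⊗ 1) = cP · G`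
(`cX = ⟨ω, [X]⟩ ≠ 0`, `cP = ⟨ω ⊠ ω, [X × X]⟩`, `ω` a generator of `H²ⁿ(X)`) is checked on the pairings
`Z ↦ ⟨Z ∪ (βₖ ⊠ βₗ), [X × X]⟩` with the basis crosses, which determine a class of `Hⁿ ⊗ Hⁿ`
(`eq_zero_of_mem_kunnethPiece_of_forall_pairing_eq_zero`: Poincaré duality over `ℂ`,
`isPerfPair_cupPairing_of_field_holds`, Künneth spanning `kunnethSpan_complexBetti`, and the vanishing of
cup products of pieces of incompatible bidegrees, `cupProduct_eq_zero_of_mem_kunnethPiece`). For `G`: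
`⟨cl(Δ) ∪ w, [X × X]⟩ = ⟨Δ^* w, [X]⟩` (`kroneckerPairing_diagonalClass_cupProduct`: cup/cap adjunction,
`capProduct_complexGysin_one`, naturality) and `Δ^*(βₖ ⊠ βₗ) = βₖ ∪ βₗ = Qₖₗ ω`; for `κ`: the interchange
law `(βᵢ ⊠ βⱼ) ∪ (βₖ ⊠ βₗ) = (−1)^{n·n} (βᵢ ∪ βₖ) ⊠ (βⱼ ∪ βₗ)` (`cupProduct_cross_cross`) and the matrix
identity `Σᵢⱼ (Q⁻¹)ᵢⱼ Qᵢₖ Qⱼₗ = (−1)^{n·n} Qₖₗ` (`Qᵀ = (−1)^{n·n} Q`, `Q Q⁻¹ = 1`).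

## References

* J. Milnor, J. Stasheff, *Characteristic Classes* (1974), Thm. 11.11 (the diagonal class
  `Σ (−1)^{dim bᵢ} bᵢ × bᵢ^#`) — context; not cited in docstrings.
* C. Voisin, *Hodge Theory and Complex Algebraic Geometry I* (2002), §11.3.3 Thm. 11.38, Lemma 11.41.
  [VoisinHodgeI2002]
* P. Deligne, *Hodge cycles on abelian varieties*, LNM 900 (1982), §2 Example 2.1 (b). [Deligne1982HodgeCycles]
* A. Hatcher, *Algebraic Topology* (2002), §3.2 Thm. 3.11, 3.15–3.16, §3.3 Thm. 3.26, Prop. 3.38, p. 241.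
  [HatcherAT2002]
* W. Fulton, *Young Tableaux* (1997), Appendix B §B.1 (5)–(6), §B.3. [FultonYoungTableaux1997]
-/

noncomputable section

open CategoryTheory MonoidalCategory CartesianMonoidalCategory
open Literature.AlgebraicTopology.SingularHomology
open Literature.AlgebraicGeometry.Motives

namespace Literature.AlgebraicGeometry.HodgeTheory

open BettiUniverse

variable {n : ℕ} {X : Motives.SchemeOver ℂ}

/-! ### §1 Cross products on `X ⊗ X`: interchange and overflow -/

/-- **Interchange law for cross products**: `(pr₁^*a ∪ pr₂^*b) ∪ (pr₁^*a' ∪ pr₂^*b') =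
(−1)^{deg b · deg a'} pr₁^*(a ∪ a') ∪ pr₂^*(b ∪ b')` (associativity and graded commutativity of the
cup product, naturality under `pr₁^*`, `pr₂^*`). [cite: HatcherAT2002, §3.2 Thm. 3.11 and Prop. 3.10] -/
theorem cupProduct_cross_cross {i j i' j' k k' m s t : ℕ} (hij : i + j = k) (hij' : i' + j' = k')
    (hkk : k + k' = m) (hs : i + i' = s) (ht : j + j' = t) (hst : s + t = m)
    (a : complexBetti X i) (b : complexBetti X j) (a' : complexBetti X i') (b' : complexBetti X j') :
    cupProduct hkk
        (cupProduct hij (complexBetti.map (fst X X) i a) (complexBetti.map (snd X X) j b))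
        (cupProduct hij' (complexBetti.map (fst X X) i' a') (complexBetti.map (snd X X) j' b')) =
      ((-1 : ℂ) ^ (j * i')) • cupProduct hst
        (complexBetti.map (fst X X) s (cupProduct hs a a'))
        (complexBetti.map (snd X X) t (cupProduct ht b b')) := by
  -- `(A ∪ B) ∪ (A' ∪ B') = A ∪ (B ∪ (A' ∪ B')) = A ∪ ((B ∪ A') ∪ B') = ± A ∪ ((A' ∪ B) ∪ B')`
  --   `= ± A ∪ (A' ∪ (B ∪ B')) = ± (A ∪ A') ∪ (B ∪ B')`
  set A := complexBetti.map (fst X X) i a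
  set B := complexBetti.map (snd X X) j b
  set A' := complexBetti.map (fst X X) i' a'
  set B' := complexBetti.map (snd X X) j' b'
  rw [cupProduct_assoc hij (show j + k' = j + k' from rfl) hkk (by omega) A B,
    ← cupProduct_assoc (show j + i' = j + i' from rfl) hij' (show j + i' + j' = j + k' by omega)
      (show j + k' = j + k' from rfl) B A' B',
    cupProduct_gradedComm_holds ℂ (ComplexPoints (X ⊗ X)) (show j + i' = j + i' from rfl)
      (show i' + j = j + i' by omega) B A',
    LinearMap.map_smul₂, map_smul,
    cupProduct_assoc (show i' + j = j + i' by omega) ht (show j + i' + j' = j + k' by omega)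
      (show i' + t = j + k' by omega) A' B,
    ← cupProduct_assoc hs (show i' + t = j + k' by omega) hst (show i + (j + k') = m by omega) A A']
  simp only [A, B, A', B', complexBetti.map, cupProduct_map]

/-- `Hᵏ(X(ℂ); ℂ) = 0` above the top degree, element form. [cite: HatcherAT2002, §3.3 Thm. 3.26(c)] -/
private theorem complexBetti_elem_eq_zero_of_lt (hX : IsSmoothProjective n X) {k : ℕ} (hk : 2 * n < k)
    (x : complexBetti X k) : x = 0 := by
  haveI := subsingleton_complexBetti hX hk
  exact Subsingleton.elim _ _

/-- **Overflow**: a cross product `pr₁^*a ∪ pr₂^*b` on `X ⊗ X` with `deg a > 2 dim X` or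
`deg b > 2 dim X` vanishes. [cite: HatcherAT2002, §3.3 Thm. 3.26(c)] -/
theorem cupProduct_cross_eq_zero_of_lt (hX : IsSmoothProjective n X) {s t m : ℕ} (hst : s + t = m)
    (h : 2 * n < s ∨ 2 * n < t) (a : complexBetti X s) (b : complexBetti X t) :
    cupProduct hst (complexBetti.map (fst X X) s a) (complexBetti.map (snd X X) t b) = 0 := by
  rcases h with h | h
  · rw [complexBetti_elem_eq_zero_of_lt hX h a, map_zero, LinearMap.map_zero₂]
  · rw [complexBetti_elem_eq_zero_of_lt hX h b, map_zero, map_zero]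


/-! ### §2 From rational to complex coefficients -/

/-- `Hᵏ(X(ℂ); ℂ)` vanishes when `Hᵏ(X(ℂ); ℚ)` does (rational classes span). [cite: HatcherAT2002, §3.1 Thm. 3.2] -/
theorem complexBetti_eq_zero_of_subsingleton (hX : IsSmoothProjective n X) {k : ℕ}
    [Subsingleton (bettiCohomology X k)] (x : complexBetti X k) : x = 0 := by
  have hx : x ∈ Submodule.span ℂ {c : complexBetti X k | IsRationalClass c} := by
    rw [span_isRationalClass_eq_top_of_isSmoothProjective_holds n X hX k]; exact Submodule.mem_top
  have hle : Submodule.span ℂ {c : complexBetti X k | IsRationalClass c} ≤ ⊥ := by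
    refine Submodule.span_le.2 fun c hc ↦ ?_
    obtain ⟨z, rfl⟩ := (isRationalClass_iff_mem_range_ofRatClass c).1 hc
    rw [Subsingleton.elim z 0, map_zero]
    exact (Submodule.mem_bot ℂ).2 rfl
  exact (Submodule.mem_bot ℂ).1 (hle hx)

/-- A complex class of degree `2a` is algebraic as soon as every rational class of that degree has
algebraic complexification (rational classes span). [cite: HatcherAT2002, §3.1 Thm. 3.2] -/
theorem mem_algebraicClasses_of_forall_ofRatClass (hX : IsSmoothProjective n X) {a : ℕ}
    (h : ∀ z : bettiCohomology X (2 * a), ofRatClass (ComplexPoints X) (2 * a) z ∈ algebraicClasses X a)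
    (x : complexBetti X (2 * a)) : x ∈ algebraicClasses X a := by
  have hx : x ∈ Submodule.span ℂ {c : complexBetti X (2 * a) | IsRationalClass c} := by
    rw [span_isRationalClass_eq_top_of_isSmoothProjective_holds n X hX (2 * a)]; exact Submodule.mem_top
  refine (Submodule.span_le.2 fun c hc ↦ ?_) hx
  obtain ⟨z, rfl⟩ := (isRationalClass_iff_mem_range_ofRatClass c).1 hc
  exact h z

/-- The complexifications of a `ℚ`-basis of `Hᵏ(X(ℂ); ℚ)` span `Hᵏ(X(ℂ); ℂ)`. [cite: HatcherAT2002, §3.1 Thm. 3.2] -/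
theorem mem_span_ofRatClass_basis (hX : IsSmoothProjective n X) {k : ℕ} {ι : Type*}
    (b : Module.Basis ι ℚ (bettiCohomology X k)) (x : complexBetti X k) :
    x ∈ Submodule.span ℂ (Set.range fun i ↦ ofRatClass (ComplexPoints X) k (b i)) := by
  have hx : x ∈ Submodule.span ℂ {c : complexBetti X k | IsRationalClass c} := by
    rw [span_isRationalClass_eq_top_of_isSmoothProjective_holds n X hX k]; exact Submodule.mem_top
  refine (Submodule.span_le.2 fun c hc ↦ ?_) hx
  obtain ⟨z, rfl⟩ := (isRationalClass_iff_mem_range_ofRatClass c).1 hc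
  rw [SetLike.mem_coe, ← b.linearCombination_repr z, Finsupp.linearCombination_apply, Finsupp.sum,
    map_sum]
  refine Submodule.sum_mem _ fun i _ ↦ ?_
  rw [ofRatClass_smul]
  exact Submodule.smul_mem _ _ (Submodule.subset_span ⟨i, rfl⟩)

/-! ### §3 The top line and the Kronecker pairing with the fundamental class -/

/-- On the top line `H²ⁿ(X(ℂ); ℚ) = ℚ · ω₀` (`ω₀ = lineBasis`), `z ⊗ 1 = tr(z) · (ω₀ ⊗ 1)`.
[cite: HatcherAT2002, §3.3 Thm. 3.26] -/
theorem ofRatClass_top_eq_smul (hX : IsSmoothProjective n X) (z : bettiCohomology X (2 * n)) :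
    ofRatClass (ComplexPoints X) (2 * n) z =
      ((tr hX (2 * n) z : ℚ) : ℂ) •
        ofRatClass (ComplexPoints X) (2 * n) (lineBasis hX (2 * n) (finrank_bettiCohomology_top hX) 0) := by
  have h1 := finrank_bettiCohomology_top hX
  conv_lhs => rw [← (lineBasis hX (2 * n) h1).sum_repr z]
  rw [Fin.sum_univ_one, ofRatClass_smul, tr_of_finrank_eq_one hX h1, Module.Basis.coord_apply]

/-- The chosen generator `ω₀ ⊗ 1` of `H²ⁿ(X(ℂ); ℂ)` is non-zero. [cite: HatcherAT2002, §3.3 Thm. 3.26] -/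
theorem ofRatClass_lineBasis_ne_zero (hX : IsSmoothProjective n X) :
    ofRatClass (ComplexPoints X) (2 * n) (lineBasis hX (2 * n) (finrank_bettiCohomology_top hX) 0) ≠ 0 := by
  intro h
  have h' := ofRatClass_injective (Y := ComplexPoints X) (2 * n) (h.trans (map_zero _).symm)
  exact (lineBasis hX (2 * n) (finrank_bettiCohomology_top hX)).ne_zero 0 h'

/-- **The Kronecker pairing with the fundamental class detects the top degree**: for `X` smooth
projective of dimension `d` and an orientation family `μ`, `⟨z, [X(ℂ)]_μ⟩ = 0` only for `z = 0` in
`H^{2d}(X(ℂ); ℂ)` (`H^{2d}` is a line on which `⟨–, [X(ℂ)]⟩ ≠ 0`). [cite: HatcherAT2002, §3.3 Thm. 3.26 and §3.1 Thm. 3.2] -/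
private theorem eq_zero_of_kroneckerPairing_top_eq_zero (μ : OrientationFamily) {d : ℕ}
    {Z : Motives.SchemeOver ℂ} (hZ : IsSmoothProjective d Z) {z : complexBetti Z (2 * d)}
    (hz : kroneckerPairing ℂ ℂ (ComplexPoints Z) (2 * d) z (μ hZ).fundamentalClass = 0) : z = 0 := by
  letI := hZ.chartedSpace
  haveI := ComplexPoints.compactSpace_of_isSmoothProjective hZ
  haveI := ComplexPoints.t2Space_of_isSmoothProjective hZ
  haveI := connectedSpace_complexPoints hZ
  have hne : (μ hZ).fundamentalClass ≠ 0 := fundamentalClass_ne_zero (μ hZ)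
  obtain ⟨θ, hθ⟩ : ∃ θ : Module.Dual ℂ (singularHomology ℂ ℂ (ComplexPoints Z) (2 * d)),
      θ (μ hZ).fundamentalClass ≠ 0 := by
    by_contra h
    push Not at h
    exact hne ((Module.forall_dual_apply_eq_zero_iff ℂ _).1 h)
  obtain ⟨G₀, hG₀⟩ := kroneckerPairing_surjective ℂ (ComplexPoints Z) (2 * d) θ
  have hG₀ne : G₀ ≠ 0 := by
    rintro rfl
    rw [map_zero] at hG₀
    exact hθ (by rw [← hG₀, LinearMap.zero_apply])
  obtain ⟨t, rfl⟩ := exists_eq_smul_of_top μ hZ hG₀ne z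
  rw [map_smul, LinearMap.smul_apply, hG₀, smul_eq_mul] at hz
  rcases mul_eq_zero.1 hz with ht | ht
  · rw [ht, zero_smul]
  · exact absurd ht hθ

/-- **`⟨cl(Δ) ∪ w, [X × X]⟩ = ⟨Δ^* w, [X]⟩`** for `w ∈ H²ⁿ((X ⊗ X)(ℂ); ℂ)`: cup and cap are adjoint
under the Kronecker pairing, `cl(Δ) ⌢ [X × X] = Δ(ℂ)_*[X]` (`capProduct_complexGysin_one`), and the
Kronecker pairing is natural. [cite: FultonYoungTableaux1997, Appendix B §B.1 (5) and §B.3]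
[cite: HatcherAT2002, §3.3 p. 241] -/
theorem kroneckerPairing_diagonalClass_cupProduct (hX : IsSmoothProjective n X)
    (h : 2 * n + 2 * n = 2 * (n + n)) (w : complexBetti (X ⊗ X) (2 * n)) :
    kroneckerPairing ℂ ℂ (ComplexPoints (X ⊗ X)) (2 * (n + n)) (cupProduct h (diagonalClass hX) w)
        (complexOrientationFamily (hX.tensor_holds hX)).fundamentalClass =
      kroneckerPairing ℂ ℂ (ComplexPoints X) (2 * n) (complexBetti.map (lift (𝟙 X) (𝟙 X)) (2 * n) w)
        (complexOrientationFamily hX).fundamentalClass := by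
  rw [kroneckerPairing_cupProduct, diagonalClass,
    capProduct_complexGysin_one hasPoincareDuality_complexOrientationFamily hX (hX.tensor_holds hX)
      (lift (𝟙 X) (𝟙 X)) (rfl : n + n = n + n),
    complexBetti.map, kroneckerPairing_map]

/-! ### §4 The Künneth pieces of `cl(Δ)` off the middle bidegree are algebraic -/

/-- Künneth pieces with equal bidegrees agree (transport of the degree indices). [folklore] -/
private theorem kunnethPiece_eq_of_eq {Y : Motives.SchemeOver ℂ} {i i' j j' k : ℕ} (ei : i = i') (ej : j = j')
    (h : i + j = k) (h' : i' + j' = k) : kunnethPiece X Y h = kunnethPiece X Y h' := by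
  subst ei ej
  rfl

/-- **Off the middle bidegree the Künneth pieces of `H²ⁿ(X × X)` are algebraic** when `X` (smooth
projective of dimension `n`) has no odd cohomology off degree `n` and algebraic even cohomology off
degree `n`: the piece `Hⁱ ⊗ Hʲ`, `i + j = 2n`, `j ≠ n`, is `0` for `j` odd and spanned by exterior
products of algebraic classes for `j` even (`cupProduct_map_fst_map_snd_mem_algebraicClasses`).
[cite: VoisinHodgeI2002, §11.3.3 Thm. 11.38 and proof of Lemma 11.41] -/
theorem kunnethPiece_le_algebraicClasses_of_ne (hX : IsSmoothProjective n X)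
    (hodd : ∀ k, Odd k → k ≠ n → Subsingleton (bettiCohomology X k))
    (heven : ∀ (a : ℕ) (z : bettiCohomology X (2 * a)), 2 * a ≠ n →
      ofRatClass (ComplexPoints X) (2 * a) z ∈ algebraicClasses X a)
    {i j : ℕ} (h : i + j = 2 * n) (hj : j ≠ n) :
    kunnethPiece X X h ≤ algebraicClasses (X ⊗ X) n := by
  refine Submodule.span_le.2 ?_
  rintro _ ⟨a, b, rfl⟩
  rcases Nat.even_or_odd j with ⟨k, hk⟩ | hjo
  · obtain ⟨k, rfl⟩ : ∃ k', j = 2 * k' := ⟨k, by omega⟩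
    obtain ⟨l, rfl⟩ : ∃ l, i = 2 * l := ⟨n - k, by omega⟩
    obtain rfl : n = l + k := by omega
    have ha : a ∈ algebraicClasses X l :=
      mem_algebraicClasses_of_forall_ofRatClass hX (fun z ↦ heven l z (by omega)) a
    have hb : b ∈ algebraicClasses X k :=
      mem_algebraicClasses_of_forall_ofRatClass hX (fun z ↦ heven k z (by omega)) b
    exact cupProduct_map_fst_map_snd_mem_algebraicClasses hX hX ha hb
  · haveI := hodd j hjo hj
    rw [SetLike.mem_coe, complexBetti_eq_zero_of_subsingleton hX b, map_zero, map_zero]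
    exact Submodule.zero_mem _

/-- **The middle Künneth component of `cl(Δ)` is algebraic**: `cl(Δ) = Σᵢ πⁱ` with `πⁱ ∈ H^{2n−i} ⊗ Hⁱ`
(`exists_sum_kunnethPiece_eq`), `cl(Δ)` is algebraic (`diagonalClass_mem_algebraicClasses`), and so
are the `πⁱ`, `i ≠ n`, under the hypotheses of `kunnethPiece_le_algebraicClasses_of_ne`; hence
`πⁿ = cl(Δ) − Σ_{i ≠ n} πⁱ` is. [cite: VoisinHodgeI2002, §11.3.3 proof of Lemma 11.41]
[cite: Deligne1982HodgeCycles, §2 Example 2.1 (b) (p. 15)] -/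
theorem exists_middle_kunnethComponent_diagonalClass (hX : IsSmoothProjective n X)
    (hodd : ∀ k, Odd k → k ≠ n → Subsingleton (bettiCohomology X k))
    (heven : ∀ (a : ℕ) (z : bettiCohomology X (2 * a)), 2 * a ≠ n →
      ofRatClass (ComplexPoints X) (2 * a) z ∈ algebraicClasses X a)
    (h : n + n = 2 * n) :
    ∃ (G : complexBetti (X ⊗ X) (2 * n)) (π : Fin (2 * n + 1) → complexBetti (X ⊗ X) (2 * n)),
      G ∈ kunnethPiece X X h ∧ G ∈ algebraicClasses (X ⊗ X) n ∧
      (∀ i : Fin (2 * n + 1), (i : ℕ) ≠ n →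
        π i ∈ kunnethPiece X X (show (2 * n - (i : ℕ)) + i = 2 * n by omega)) ∧
      diagonalClass hX = G + ∑ i ∈ Finset.univ.erase ⟨n, by omega⟩, π i := by
  obtain ⟨π, hπ, hsum⟩ := exists_sum_kunnethPiece_eq hX hX (2 * n) (diagonalClass hX)
  refine ⟨π ⟨n, by omega⟩, π, ?_, ?_, fun i _ ↦ hπ i, ?_⟩
  · have e := kunnethPiece_eq_of_eq (X := X) (Y := X) (show 2 * n - n = n by omega) rfl
      (show (2 * n - n) + n = 2 * n by omega) h
    rw [← e]
    exact hπ ⟨n, by omega⟩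
  · have hrest : ∑ i ∈ Finset.univ.erase (⟨n, by omega⟩ : Fin (2 * n + 1)), π i ∈
        algebraicClasses (X ⊗ X) n := by
      refine Submodule.sum_mem _ fun i hi ↦ ?_
      have hi' : (i : ℕ) ≠ n := fun e ↦ (Finset.mem_erase.1 hi).1 (Fin.ext e)
      exact kunnethPiece_le_algebraicClasses_of_ne hX hodd heven _ hi' (hπ i)
    have hG : π ⟨n, by omega⟩ = diagonalClass hX - ∑ i ∈ Finset.univ.erase ⟨n, by omega⟩, π i := by
      rw [← hsum, ← Finset.add_sum_erase _ _ (Finset.mem_univ (⟨n, by omega⟩ : Fin (2 * n + 1))),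
        add_sub_cancel_right]
    rw [hG]
    exact Submodule.sub_mem _ (diagonalClass_mem_algebraicClasses hX) hrest
  · rw [← hsum, ← Finset.add_sum_erase _ _ (Finset.mem_univ (⟨n, by omega⟩ : Fin (2 * n + 1)))]


/-! ### §5 Cup products of Künneth pieces of incompatible bidegrees vanish -/

/-- Cup products `Z ∪ W` of classes in Künneth pieces `Hⁱ ⊗ Hʲ`, `H^{i'} ⊗ H^{j'}` with
`i + i' > 2 dim X` or `j + j' > 2 dim X` vanish (interchange law and overflow).
[cite: HatcherAT2002, §3.2 Thm. 3.11 and §3.3 Thm. 3.26(c)] -/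
theorem cupProduct_eq_zero_of_mem_kunnethPiece (hX : IsSmoothProjective n X) {i j i' j' k k' m : ℕ}
    (hij : i + j = k) (hij' : i' + j' = k') (hkk : k + k' = m) (hover : 2 * n < i + i' ∨ 2 * n < j + j')
    {Z : complexBetti (X ⊗ X) k} {W : complexBetti (X ⊗ X) k'} (hZ : Z ∈ kunnethPiece X X hij)
    (hW : W ∈ kunnethPiece X X hij') : cupProduct hkk Z W = 0 := by
  have hgen : ∀ (a : complexBetti X i) (b : complexBetti X j), ∀ W ∈ kunnethPiece X X hij',
      cupProduct hkk (cupProduct hij (complexBetti.map (fst X X) i a) (complexBetti.map (snd X X) j b)) W = 0 := by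
    intro a b W hW
    induction hW using Submodule.span_induction with
    | mem w hw =>
      obtain ⟨a', b', rfl⟩ := hw
      rw [cupProduct_cross_cross hij hij' hkk rfl rfl (by omega) a b a' b',
        cupProduct_cross_eq_zero_of_lt hX _ hover, smul_zero]
    | zero => rw [map_zero]
    | add w w' _ _ hw hw' => rw [map_add, hw, hw', add_zero]
    | smul c w _ hw => rw [map_smul, hw, smul_zero]
  induction hZ using Submodule.span_induction with
  | mem z hz =>
    obtain ⟨a, b, rfl⟩ := hz
    exact hgen a b W hW
  | zero => rw [LinearMap.map_zero₂]
  | add z z' _ _ hz hz' => rw [LinearMap.map_add₂, hz, hz', add_zero]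
  | smul c z _ hz => rw [LinearMap.map_smul₂, hz, smul_zero]

/-! ### §6 The trace at degree `n + n` versus `2n` -/

/-- The light trace of a cup product does not depend on the spelling `n + n` / `2n` of the top degree.
[folklore] -/
private theorem tr_bettiCup_eq_tr_cup (hX : IsSmoothProjective n X) {m : ℕ} (h : n + n = m) (x y : bettiCohomology X n) :
    tr hX m (bettiCup h x y) = tr hX (n + n) (cup X n n x y) := by
  subst h
  rfl

/-! ### §7 Uniqueness: a class in `Hⁿ ⊗ Hⁿ` is determined by its pairings with the basis crosses -/

/-- **A class `Z` in the middle Künneth piece `Hⁿ ⊗ Hⁿ ⊂ H²ⁿ(X × X)` with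
`⟨Z ∪ (pr₁^*βₖ ∪ pr₂^*βₗ), [X × X]⟩ = 0` for all elements `βₖ ⊗ 1` of a rational basis vanishes**:
the other Künneth pieces pair to zero with `Z` for degree reasons, all pieces span
(`kunnethSpan_complexBetti`), and the cup product pairing of the closed oriented manifold
`(X × X)(ℂ)` is perfect over `ℂ` (`isPerfPair_cupPairing_of_field_holds`).
[cite: HatcherAT2002, §3.3 Prop. 3.38 and §3.2 Thm. 3.15–3.16] -/
theorem eq_zero_of_mem_kunnethPiece_of_forall_pairing_eq_zero (hX : IsSmoothProjective n X)
    {ι : Type*} [Fintype ι] (b : Module.Basis ι ℚ (bettiCohomology X n)) (h : n + n = 2 * n)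
    (hh : 2 * n + 2 * n = 2 * (n + n)) {Z : complexBetti (X ⊗ X) (2 * n)} (hZ : Z ∈ kunnethPiece X X h)
    (h0 : ∀ k l : ι, cupPairing (complexOrientationFamily (hX.tensor_holds hX)) hh Z
      (cupProduct h (complexBetti.map (fst X X) n (ofRatClass (ComplexPoints X) n (b k)))
        (complexBetti.map (snd X X) n (ofRatClass (ComplexPoints X) n (b l)))) = 0) :
    Z = 0 := by
  have hP := hX.tensor_holds hX
  letI := hP.chartedSpace
  haveI := ComplexPoints.compactSpace_of_isSmoothProjective hP
  haveI := ComplexPoints.t2Space_of_isSmoothProjective hP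
  have hPP : (cupPairing (complexOrientationFamily hP) hh).IsPerfPair := isPerfPair_cupPairing_of_field_holds
  refine hPP.bijective_left.1 (?_ : _ = cupPairing (complexOrientationFamily hP) hh 0)
  rw [map_zero]
  refine LinearMap.ext fun w ↦ ?_
  rw [LinearMap.zero_apply]
  have hle : Submodule.span ℂ {v | ∃ (i j : ℕ) (h'' : i + j = 2 * n) (a : complexBetti X i)
        (b' : complexBetti X j),
        v = cupProduct h'' (complexBetti.map (fst X X) i a) (complexBetti.map (snd X X) j b')} ≤
      LinearMap.ker (cupPairing (complexOrientationFamily hP) hh Z) := by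
    refine Submodule.span_le.2 ?_
    rintro _ ⟨i, j, h'', a, b', rfl⟩
    rw [SetLike.mem_coe, LinearMap.mem_ker]
    by_cases hi : i = n
    · have hi' : n = i := hi.symm
      subst hi'
      have hj : n = j := by omega
      subst hj
      obtain ⟨c, rfl⟩ := (Submodule.mem_span_range_iff_exists_fun ℂ).1 (mem_span_ofRatClass_basis hX b a)
      obtain ⟨c', rfl⟩ := (Submodule.mem_span_range_iff_exists_fun ℂ).1 (mem_span_ofRatClass_basis hX b b')
      simp only [map_sum, map_smul, LinearMap.sum_apply, LinearMap.smul_apply, h0, smul_zero,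
        Finset.sum_const_zero]
    · rw [cupPairing_apply, cupProduct_eq_zero_of_mem_kunnethPiece hX h h'' hh (by omega) hZ
        (cupProduct_fst_snd_mem_kunnethPiece h'' a b'), map_zero, LinearMap.zero_apply]
  exact LinearMap.mem_ker.1 (hle (kunnethSpan_complexBetti hX hX (2 * n) w))


/-! ### §8 The Poincaré Casimir of `Hⁿ(X; ℚ)` is algebraic on `X × X` -/

/-- **The middle Künneth component of the diagonal is the Poincaré Casimir, which is therefore
algebraic.** Let `X` be smooth projective of dimension `n` with `Hᵏ(X(ℂ); ℚ) = 0` for odd `k ≠ n` and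
all of `H^{2a}(X(ℂ); ℚ)` (`2a ≠ n`) of algebraic complexification; let `b` be a `ℚ`-basis of
`Hⁿ(X(ℂ); ℚ)` and `Q = (tr(bᵢ ∪ bⱼ))` the Gram matrix of the (light) trace form — invertible by Poincaré
duality (`nondegenerate_tr_cup`). Then the **Casimir element**
`Σᵢⱼ (Q⁻¹)ᵢⱼ · pr₁^*bᵢ ∪ pr₂^*bⱼ ∈ H²ⁿ((X × X)(ℂ); ℚ)` has ALGEBRAIC complexification: it is a non-zero
multiple of the Künneth component `πⁿ ∈ Hⁿ ⊗ Hⁿ` of `cl(Δ)`, which is `cl(Δ)` minus the algebraic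
pieces `πⁱ`, `i ≠ n` (`exists_middle_kunnethComponent_diagonalClass`). The identification is made
through the perfect pairing `⟨– ∪ –, [X × X]⟩`: on the test classes `βₖ ⊠ βₗ` both `πⁿ` and the
Casimir pair to multiples of `Qₖₗ` — `⟨cl(Δ) ∪ w, [X × X]⟩ = ⟨Δ^*w, [X]⟩`
(`kroneckerPairing_diagonalClass_cupProduct`) and `(βᵢ ⊠ βⱼ) ∪ (βₖ ⊠ βₗ) = ± (βᵢ ∪ βₖ) ⊠ (βⱼ ∪ βₗ)` —
and a class of `Hⁿ ⊗ Hⁿ` is determined by these pairings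
(`eq_zero_of_mem_kunnethPiece_of_forall_pairing_eq_zero`). This is the input "the Künneth components
of the diagonal are algebraic" of Kleiman's / Voisin's treatment for varieties whose cohomology off the
middle degree is algebraic (e.g. hypersurfaces). The cup product on `X × X` is taken in degree `2p`,
`n + n = 2p`, so that the conclusion is a membership in `algebraicClasses (X ⊗ X) p`.
[cite: VoisinHodgeI2002, §11.3.3 Thm. 11.38 and Lemma 11.41] [cite: Deligne1982HodgeCycles, §2 Example 2.1 (b) (p. 15)]
[cite: HatcherAT2002, §3.3 Prop. 3.38] -/
theorem ofRatClass_casimir_mem_algebraicClasses (hX : IsSmoothProjective n X)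
    (hodd : ∀ k, Odd k → k ≠ n → Subsingleton (bettiCohomology X k))
    (heven : ∀ (a : ℕ) (z : bettiCohomology X (2 * a)), 2 * a ≠ n →
      ofRatClass (ComplexPoints X) (2 * a) z ∈ algebraicClasses X a)
    {ι : Type*} [Fintype ι] [DecidableEq ι] (b : Module.Basis ι ℚ (bettiCohomology X n))
    {p : ℕ} (h : n + n = 2 * p) :
    ofRatClass (ComplexPoints (X ⊗ X)) (2 * p)
        (∑ i, ∑ j, (Matrix.of fun i j ↦ ((cup X n n).compr₂ (tr hX (n + n))) (b i) (b j))⁻¹ i j •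
          bettiCup h (pull (fst X X) n (b i)) (pull (snd X X) n (b j))) ∈
      algebraicClasses (X ⊗ X) p := by
  have hp : n = p := by omega
  subst hp
  classical
  -- notation
  have hP := hX.tensor_holds hX
  have hh : 2 * n + 2 * n = 2 * (n + n) := by ring
  set Q : Matrix ι ι ℚ := Matrix.of fun i j ↦ ((cup X n n).compr₂ (tr hX (n + n))) (b i) (b j) with hQdef
  set β : ι → complexBetti X n := fun i ↦ ofRatClass (ComplexPoints X) n (b i) with hβ
  set ω : complexBetti X (2 * n) :=
    ofRatClass (ComplexPoints X) (2 * n) (lineBasis hX (2 * n) (finrank_bettiCohomology_top hX) 0) with hω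
  set Φ := cupPairing (complexOrientationFamily hP) hh with hΦ
  set cX : ℂ := kroneckerPairing ℂ ℂ (ComplexPoints X) (2 * n) ω (complexOrientationFamily hX).fundamentalClass
    with hcX
  set cP : ℂ := kroneckerPairing ℂ ℂ (ComplexPoints (X ⊗ X)) (2 * (n + n))
    (cupProduct hh (complexBetti.map (fst X X) (2 * n) ω) (complexBetti.map (snd X X) (2 * n) ω))
    (complexOrientationFamily hP).fundamentalClass with hcP
  -- the Gram matrix is invertible and `(−1)^{n n}`-symmetric
  have hQapply : ∀ i j, Q i j = tr hX (n + n) (cup X n n (b i) (b j)) := fun i j ↦ rfl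
  have hQsymm : ∀ i j, Q i j = (-1 : ℚ) ^ (n * n) * Q j i := by
    intro i j
    rw [hQapply, hQapply, show cup X n n (b i) (b j) = ((-1 : ℚ) ^ (n * n)) • cup X n n (b j) (b i) from
      bettiCup_gradedComm (cupProduct_gradedComm_holds ℚ (ComplexPoints X)) rfl rfl (b i) (b j),
      map_smul, smul_eq_mul]
  have hQdet : IsUnit Q.det := by
    have hQ' : Q = LinearMap.BilinForm.toMatrix b ((cup X n n).compr₂ (tr hX (n + n))) := by
      ext i j
      rw [hQapply, LinearMap.BilinForm.toMatrix_apply, LinearMap.compr₂_apply]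
    rw [hQ', isUnit_iff_ne_zero]
    exact (LinearMap.BilinForm.nondegenerate_iff_det_ne_zero b).1 (nondegenerate_tr_cup hX)
  have hmat : ∀ k l, ∑ i, ∑ j, Q⁻¹ i j * (Q i k * Q j l) = (-1 : ℚ) ^ (n * n) * Q k l := by
    intro k l
    have h1 : ∀ j, ∑ i, Q⁻¹ i j * Q i k = (-1 : ℚ) ^ (n * n) * (Q * Q⁻¹) k j := by
      intro j
      rw [Matrix.mul_apply, Finset.mul_sum]
      refine Finset.sum_congr rfl fun i _ ↦ ?_
      rw [hQsymm i k]
      ring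
    calc ∑ i, ∑ j, Q⁻¹ i j * (Q i k * Q j l)
        = ∑ j, (∑ i, Q⁻¹ i j * Q i k) * Q j l := by
          rw [Finset.sum_comm]
          refine Finset.sum_congr rfl fun j _ ↦ ?_
          rw [Finset.sum_mul]
          refine Finset.sum_congr rfl fun i _ ↦ ?_
          ring
      _ = ∑ j, (-1 : ℚ) ^ (n * n) * (Q * Q⁻¹) k j * Q j l := by
          refine Finset.sum_congr rfl fun j _ ↦ ?_
          rw [h1 j]
      _ = (-1 : ℚ) ^ (n * n) * Q k l := by
          rw [Matrix.mul_nonsing_inv Q hQdet]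
          simp only [Matrix.one_apply, mul_ite, mul_one, mul_zero, ite_mul, zero_mul]
          rw [Finset.sum_ite_eq Finset.univ k, if_pos (Finset.mem_univ k)]
  -- top classes of `X`: `βᵢ ∪ βₖ = Qᵢₖ · ω`
  have hββ : ∀ i k, cupProduct h (β i) (β k) = ((Q i k : ℚ) : ℂ) • ω := by
    intro i k
    rw [hβ, ← ofRatClass_bettiCup, ofRatClass_top_eq_smul hX, tr_bettiCup_eq_tr_cup hX h, hQapply]
  -- the middle Künneth component of `cl(Δ)`
  obtain ⟨G, π, hGpiece, hGalg, hπ, hΔ⟩ := exists_middle_kunnethComponent_diagonalClass hX hodd heven h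
  -- the complexified Casimir
  set C : complexBetti (X ⊗ X) (2 * n) := ∑ i, ∑ j, ((Q⁻¹ i j : ℚ) : ℂ) •
    cupProduct h (complexBetti.map (fst X X) n (β i)) (complexBetti.map (snd X X) n (β j)) with hC
  have hCeq : ofRatClass (ComplexPoints (X ⊗ X)) (2 * n)
      (∑ i, ∑ j, Q⁻¹ i j • bettiCup h (pull (fst X X) n (b i)) (pull (snd X X) n (b j))) = C := by
    simp only [hC, map_sum, ofRatClass_smul, ofRatClass_bettiCup, ofRatClass_pull, hβ]
  rw [hCeq]
  have hCpiece : C ∈ kunnethPiece X X h := by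
    refine Submodule.sum_mem _ fun i _ ↦ Submodule.sum_mem _ fun j _ ↦ Submodule.smul_mem _ _ ?_
    exact cupProduct_fst_snd_mem_kunnethPiece h (β i) (β j)
  -- pairings with the test classes `βₖ ⊠ βₗ`
  have hpairC : ∀ k l, Φ C (cupProduct h (complexBetti.map (fst X X) n (β k))
      (complexBetti.map (snd X X) n (β l))) = cP * ((Q k l : ℚ) : ℂ) := by
    intro k l
    have hterm : ∀ i j, Φ (cupProduct h (complexBetti.map (fst X X) n (β i)) (complexBetti.map (snd X X) n (β j)))
        (cupProduct h (complexBetti.map (fst X X) n (β k)) (complexBetti.map (snd X X) n (β l))) =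
        (-1 : ℂ) ^ (n * n) * (((Q i k : ℚ) : ℂ) * ((Q j l : ℚ) : ℂ)) * cP := by
      intro i j
      rw [hΦ, cupPairing_apply, cupProduct_cross_cross h h hh h h hh, hββ, hββ]
      simp only [map_smul, LinearMap.smul_apply, smul_eq_mul, hcP]
      ring
    simp only [hC, LinearMap.map_sum₂, LinearMap.map_smul₂, hterm, smul_eq_mul]
    have hmat' := congrArg (fun q : ℚ ↦ (q : ℂ)) (hmat k l)
    simp only [Rat.cast_sum, Rat.cast_mul, Rat.cast_pow, Rat.cast_neg, Rat.cast_one] at hmat'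
    calc ∑ i, ∑ j, ((Q⁻¹ i j : ℚ) : ℂ) * ((-1 : ℂ) ^ (n * n) * (((Q i k : ℚ) : ℂ) * ((Q j l : ℚ) : ℂ)) * cP)
        = (-1 : ℂ) ^ (n * n) * cP * ∑ i, ∑ j, ((Q⁻¹ i j : ℚ) : ℂ) * (((Q i k : ℚ) : ℂ) * ((Q j l : ℚ) : ℂ)) := by
          rw [Finset.mul_sum]
          refine Finset.sum_congr rfl fun i _ ↦ ?_
          rw [Finset.mul_sum]
          refine Finset.sum_congr rfl fun j _ ↦ ?_
          ring
      _ = cP * ((Q k l : ℚ) : ℂ) := by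
          have hsq : ((-1 : ℂ) ^ (n * n)) * ((-1 : ℂ) ^ (n * n)) = 1 := by
            rw [← pow_add, ← two_mul, pow_mul, neg_one_sq, one_pow]
          rw [hmat']
          linear_combination (cP * ((Q k l : ℚ) : ℂ)) * hsq
  have hpairG : ∀ k l, Φ G (cupProduct h (complexBetti.map (fst X X) n (β k))
      (complexBetti.map (snd X X) n (β l))) = cX * ((Q k l : ℚ) : ℂ) := by
    intro k l
    have hrest : ∀ i ∈ Finset.univ.erase (⟨n, by omega⟩ : Fin (2 * n + 1)),
        Φ (π i) (cupProduct h (complexBetti.map (fst X X) n (β k)) (complexBetti.map (snd X X) n (β l))) = 0 := by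
      intro i hi
      have hi' : (i : ℕ) ≠ n := fun e ↦ (Finset.mem_erase.1 hi).1 (Fin.ext e)
      rw [hΦ, cupPairing_apply, cupProduct_eq_zero_of_mem_kunnethPiece hX _ h hh (by omega) (hπ i hi')
        (cupProduct_fst_snd_mem_kunnethPiece h (β k) (β l)), map_zero, LinearMap.zero_apply]
    have hG : G = diagonalClass hX - ∑ i ∈ Finset.univ.erase ⟨n, by omega⟩, π i := by
      rw [hΔ, add_sub_cancel_right]
    rw [hG, LinearMap.map_sub₂, LinearMap.map_sum₂, Finset.sum_eq_zero hrest, sub_zero, hΦ, cupPairing_apply,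
      kroneckerPairing_diagonalClass_cupProduct hX hh, ← cupProduct_eq_map_diagonal h (β k) (β l), hββ,
      map_smul, LinearMap.smul_apply, hcX, smul_eq_mul, mul_comm]
  -- `cX ≠ 0`
  have hcX0 : cX ≠ 0 := by
    intro h0
    exact ofRatClass_lineBasis_ne_zero hX
      (eq_zero_of_kroneckerPairing_top_eq_zero complexOrientationFamily hX h0)
  -- uniqueness: `cX • C = cP • G`
  have hZ : cX • C - cP • G = 0 := by
    refine eq_zero_of_mem_kunnethPiece_of_forall_pairing_eq_zero hX b h hh
      (Submodule.sub_mem _ (Submodule.smul_mem _ _ hCpiece) (Submodule.smul_mem _ _ hGpiece)) fun k l ↦ ?_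
    rw [LinearMap.map_sub₂, LinearMap.map_smul₂, LinearMap.map_smul₂]
    show cX • Φ C (cupProduct h (complexBetti.map (fst X X) n (β k)) (complexBetti.map (snd X X) n (β l))) -
      cP • Φ G (cupProduct h (complexBetti.map (fst X X) n (β k)) (complexBetti.map (snd X X) n (β l))) = 0
    rw [hpairC, hpairG, smul_eq_mul, smul_eq_mul]
    ring
  have hCG : C = (cX⁻¹ * cP) • G := by
    rw [sub_eq_zero] at hZ
    rw [mul_smul, ← hZ, smul_smul, inv_mul_cancel₀ hcX0, one_smul]
  rw [hCG]
  exact Submodule.smul_mem _ _ hGalg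

end Literature.AlgebraicGeometry.HodgeTheory

end
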